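import Mathlib
import Literature.Analysis.FluidPDE.HardSphereCollisionRecord
import Literature.MathematicalPhysics.KineticTheory.HardSphereEuler
import Literature.MathematicalPhysics.KineticTheory.HardSphereEulerProofs
import Summits.AtomisticToContinuum.HydrodynamicLimit.Theorems.OneFlightGossipEngineOneFlightLayeredChaosRegimes
import HarnessLib

/-!
# `OneFlightGossipEngine.OneFlightLayeredChaos` — the first rung in CONTACT COORDINATES: the two-direction input
(crux stmt-AtomisticToContinuum-14535, line `Sketch`, lead cycle c4: reduction of the registered stub
`stub_firstFlight_ghostInput : OLC.FirstFlightGhostInput θ₀` to the typed input `OLC.TwoDirectionGhostInput θ₀` below; the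
transfer `TwoDirectionGhostInput θ₀ → FirstFlightGhostInput θ₀` is `…OneFlightLayeredChaosTwoDirectionTransfer`, crux notes §G).

On a velocity fibre `v` (all `N + 1` velocities frozen) the position `x_i` of the tagged particle is re-parametrised by the
ENTRANCE DATA of its free flight against the partner's: for a contact time `t` and an incoming unit normal `ω`
(`⟪ω, v_i − v_j⟫ < 0`),
`contactPos ε x v i j t ω = x_j + π(ε ω − t (v_i − v_j))`
is the unique initial position whose free flight `u ↦ x_i + u v_i` first comes within `ε` of `u ↦ x_j + u v_j` at time
`t`, with contact normal `ω` (no wrap-around: `ε ≤ 1/4`, `‖v_i − v_j‖ t ≤ 1/4`); the Jacobian of `(t, ω) ↦ x_i` is the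
ENTRANCE LAW `ε² (−⟪ω, v_i − v_j⟫)₊ dt dσ(ω)` (`OLC.lintegral_entranceLaw_torus`, p139760). In these coordinates the
first-flight ghost event `OLC.firstFlightGhostEvent` becomes, for each `(t, ω)`, an event of the OTHER `N` positions only —
the TWO-TUBE AVOIDANCE EVENT `twoTubeEvent`: hard core at time `0`, and during `(0, t]` the ghost spheres (the `N − 1`
particles other than `i, j`, evolved on their own by the ghost flow `Ψ`) stay at distance `> ε` from the free path of `j`
and from the free path of `i` — a segment ENDING at the contact point, rigidly SHIFTED by `ε ω`. Changing `ω` to `ω'`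
shifts that one tube by `ε(ω' − ω)` (`≤ 2ε`) and leaves everything else fixed.

* `contactPos`, `contactConfig` — the contact parametrisation of `x_i` and the resulting configuration
  (`Function.update x i (contactPos …)`; it ignores the input value of `x i`);
* `othersDomain ε n i`, `othersLaw ε n i` — the hard-core set of the particles other than `i` and the uniform probability
  law on it (Lebesgue measure conditioned on it; the dummy coordinate `x i` is uniform and independent): the law of the
  others that the change of variables produces (NOT the `i`-marginal of the `(N+1)`-particle hard-core law);
* `twoTubeEvent Ψ i j emb v t ω` — the two-tube avoidance event at contact data `(t, ω)`;
* `contactCells q ε v i j t ω` — the conditioning map: the `q`-cells of all particles of `contactConfig … t ω` (the coarse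
  positions of `j` and of every ghost at time `0`, and the cell of the contact position of `i`);
* `TwoDirectionGhostInput θ₀` — the typed input (Q′) of crux notes §G3: a measurable majorant `e v (t, ω, ω')` of the
  CELL-CONDITIONAL TWO-DIRECTION SENSITIVITY `|ν̄(E_t^ω ∩ G) − ν̄(E_t^{ω'} ∩ G)|`, `G` ranging over the events of
  `contactCells`, whose flux-averaged, time-integrated, `γ`-averaged size is `≤ C σ^p/(N+1)`:
  `∫ ε² κ_v⁻¹ ∫∫ φ_v(ω) φ_v(ω') ∫_0^w e v (t, ω, ω') dt dσ dσ' dγ(v) ≤ C σ^p/(N+1)`, `φ_v(ω) = (−⟪ω, v_i − v_j⟫)₊`,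
  `κ_v = ∫ φ_v dσ`. It is implied by `ε/r`-flatness of the cell-conditional avoidance probability under `2ε`-shifts of one
  tube (ideal-gas calibration `p = 3−`, notes §G5) and implies the first rung with NO further dynamical input (the thin cell
  layer of `x_i` is paid exactly by translation invariance, bricks B1/B2 p138898/p139153, and `P(F) ≤ 1/N` by
  exchangeability). A typed HYPOTHESIS of the line (a named `Prop` the route posits; nothing is asserted, it is not a
  published fact).
-/

open scoped BigOperators ENNReal Topology
open MeasureTheory Set Filter
open Literature.Analysis.FluidPDE Literature.MathematicalPhysics.KineticTheory

namespace Summit.AtomisticToContinuum.HydrodynamicLimit.Theorems.OLC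

noncomputable section

/-! ## Contact coordinates for the tagged particle -/

section Contact

variable {n : ℕ}

/-- **Contact parametrisation of the tagged particle's position.** For positions `x`, velocities `v`, a pair `(i, j)`, a
contact time `t` and a direction `ω`: the point `x_j + π(ε ω − t (v_i − v_j))` of `𝕋³` — the initial position of `i` whose
free flight is, at time `t`, exactly at (minimal-image) offset `ε ω` from the free flight of `j`. It does not depend on
`x i`. [folklore] -/
def contactPos (ε : ℝ) (x : Fin n → T3) (v : Fin n → V3) (i j : Fin n) (t : ℝ) (ω : V3) : T3 :=
  x j + Literature.Analysis.FunctionSpaces.Torus.proj (ε • ω - t • (v i - v j))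

/-- **The configuration in contact coordinates**: `x` with the position of `i` replaced by `contactPos ε x v i j t ω`.
[folklore] -/
def contactConfig (ε : ℝ) (x : Fin n → T3) (v : Fin n → V3) (i j : Fin n) (t : ℝ) (ω : V3) : Fin n → T3 :=
  Function.update x i (contactPos ε x v i j t ω)

/-- The contact configuration at `i` is the contact position. [folklore] -/
@[simp]
theorem contactConfig_apply_self (ε : ℝ) (x : Fin n → T3) (v : Fin n → V3) (i j : Fin n) (t : ℝ) (ω : V3) :
    contactConfig ε x v i j t ω i = contactPos ε x v i j t ω := by
  simp [contactConfig]

/-- The contact configuration agrees with `x` away from `i`. [folklore] -/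
@[simp]
theorem contactConfig_apply_of_ne (ε : ℝ) (x : Fin n → T3) (v : Fin n → V3) {i : Fin n} (j : Fin n) (t : ℝ) (ω : V3)
    {k : Fin n} (hk : k ≠ i) : contactConfig ε x v i j t ω k = x k := by
  simp [contactConfig, hk]

/-- The contact position does not depend on the position of `i` (for `j ≠ i`; registered carrier lemma of this file).
[folklore] -/
theorem contactPos_update_self : ∀ {n : ℕ} (ε : ℝ) (x : Fin n → Literature.MathematicalPhysics.KineticTheory.T3) (v : Fin n → Literature.MathematicalPhysics.KineticTheory.V3) {i j : Fin n}, j ≠ i → ∀ (t : ℝ) (ω : Literature.MathematicalPhysics.KineticTheory.V3) (p : Literature.MathematicalPhysics.KineticTheory.T3), Summit.AtomisticToContinuum.HydrodynamicLimit.Theorems.OLC.contactPos ε (Function.update x i p) v i j t ω = Summit.AtomisticToContinuum.HydrodynamicLimit.Theorems.OLC.contactPos ε x v i j t ω := by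
  intro n ε x v i j hij t ω p
  simp [contactPos, hij]

/-- **The hard-core set of the particles other than `i`**: pairwise minimal-image distance `≥ ε` among the labels `≠ i`
(no condition on `x i`). [folklore] -/
def othersDomain (ε : ℝ) (n : ℕ) (i : Fin n) : Set (Fin n → T3) :=
  {x | ∀ k l : Fin n, k ≠ l → k ≠ i → l ≠ i → ε ≤ Torus.euclidDist (x k) (x l)}

/-- **The uniform law of the others**: Lebesgue (Haar) measure on `(𝕋³)ⁿ` conditioned on the hard-core set of the particles
other than `i` — the positions `≠ i` are hard-core uniform (`n − 1` spheres of diameter `ε`), the dummy coordinate `x i` is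
uniform and independent. This is the law of the others produced by integrating out `x i` from the `n`-particle hard-core
law in contact coordinates (up to the normalisation ratio `Z_{n-1}/Z_n ∈ [1, (1 − (n−1)·vol B_ε)⁻¹]`). [folklore] -/
def othersLaw (ε : ℝ) (n : ℕ) (i : Fin n) : Measure (Fin n → T3) :=
  ProbabilityTheory.cond volume (othersDomain ε n i)

end Contact

/-! ## The two-tube avoidance event and the conditioning cells -/

section TwoTube

variable {σ : ℝ} {N : ℕ}

/-- **The two-tube avoidance event at contact data `(t, ω)`** (an event of the positions other than `i`; velocities `v`
frozen). With `x' := contactConfig ε x v i j t ω` and `z := zipConfig (x', v)`: the configuration `x'` has no overlap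
(`posDomain`: hard core among the others AND between the contact-parametrised `i` and everybody at time `0`), the ghost
part `z ∘ emb` is good for the ghost flow `Ψ`, and during `(0, t]` every ghost sphere stays at distance `> ε` from the free
flight of `i` (issued from the contact position: the segment `u ↦ x_j + u v_j − (t − u)(v_i − v_j) + ε ω` ending at the
contact point) and from the free flight of `j`. For `t` the entrance time and `ω` the contact normal this is the
first-flight ghost event `firstFlightGhostEvent Ψ i j emb w` read in contact coordinates (`…TwoDirectionTransfer`).
[folklore] -/
def twoTubeEvent (Ψ : HardSphereFlow (Torus.geometry (Fin 3)) (hsDiameter σ N) (N - 1)) (i j : Fin (N + 1))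
    (emb : Fin (N - 1) ↪ Fin (N + 1)) (v : Fin (N + 1) → V3) (t : ℝ) (ω : V3) : Set (Fin (N + 1) → T3) :=
  {x | contactConfig (hsDiameter σ N) x v i j t ω ∈ posDomain (hsDiameter σ N) (N + 1) ∧
    ((zipConfig (contactConfig (hsDiameter σ N) x v i j t ω, v)) ∘ emb : Config (N - 1) (Fin 3) T3) ∈ Ψ.good ∧
    ∀ u ∈ Set.Ioc 0 t, ∀ k : Fin (N - 1),
      hsDiameter σ N < ‖(Torus.geometry (Fin 3)).sepVec
        (Ψ.flow u ((zipConfig (contactConfig (hsDiameter σ N) x v i j t ω, v)) ∘ emb) k).1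
        (freeFlight (Torus.geometry (Fin 3)) u (zipConfig (contactConfig (hsDiameter σ N) x v i j t ω, v)) i).1‖ ∧
      hsDiameter σ N < ‖(Torus.geometry (Fin 3)).sepVec
        (Ψ.flow u ((zipConfig (contactConfig (hsDiameter σ N) x v i j t ω, v)) ∘ emb) k).1
        (freeFlight (Torus.geometry (Fin 3)) u (zipConfig (contactConfig (hsDiameter σ N) x v i j t ω, v)) j).1‖}

/-- **The conditioning cells**: the `q`-cells of every particle of the contact configuration at contact data `(t, ω)`,
i.e. the cells of `j` and of all ghosts at time `0` together with the cell of the contact position of `i`. [folklore] -/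
def contactCells (q : T3 → (Fin 3 → ℤ)) (ε : ℝ) (v : Fin (N + 1) → V3) (i j : Fin (N + 1)) (t : ℝ) (ω : V3)
    (x : Fin (N + 1) → T3) : Fin (N + 1) → (Fin 3 → ℤ) :=
  fun k => q (contactConfig ε x v i j t ω k)

end TwoTube

/-! ## The typed input -/

/-- **Two-direction ghost input (the first rung in contact coordinates; typed dynamical input (Q′) of crux notes §G).**
Velocities of all `N + 1` particles frozen (`γ = ⊗ gauss(0, θ₀)` only averages the final bound), the OTHER positions
distributed by the uniform hard-core law `ν̄ = othersLaw ε (N+1) i`, a fixed pair `j ≠ i`, ghosts enumerated by `emb` and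
evolved by ANY hard-sphere flow `Ψ` of `N − 1` spheres, window `w = τ (N+1)^{-1/3}`, cells of mesh
`ρ⋆(σ)(N+1)^{-1/3}`: there is a measurable majorant `e v (t, ω, ω')` of the CELL-CONDITIONAL TWO-DIRECTION SENSITIVITY of
the two-tube avoidance probability — for every contact time `t ∈ (0, w]`, incoming unit normals `ω, ω'` and every event `G`
of the cells `contactCells … t ω'` of the contact configuration at `ω'`, `ν̄(E_t^ω ∩ G) ≤ ν̄(E_t^{ω'} ∩ G) + e` and
symmetrically (so, `ω, ω'` being arbitrary, also for the cells at `ω`) — whose flux-averaged,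
time-integrated, `γ`-averaged size is small:
`∫ ε² κ_v⁻¹ ∬ φ_v(ω) φ_v(ω') ∫_{(0,w]} e v (t, ω, ω') dt dσ(ω) dσ(ω') dγ(v) ≤ C σ^p/(N+1)`,
`φ_v(ω) = (−⟪ω, v_i − v_j⟫)₊` on the unit sphere, `κ_v = ∫ φ_v dσ` (`= π‖v_i − v_j‖`), for `σ < σ₀` and `N ≥ N₀(σ, τ)`.
By `…TwoDirectionTransfer` it implies `FirstFlightGhostInput θ₀` (entrance-law coordinates, exact thin-cell price by
translation invariance, `P(F) ≤ 1/N` by exchangeability); heuristically `p = 3−` (Poisson calibration, notes §G5); what its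
proof must control is the `L¹(cells)` flatness of the joint avoidance probability of two thin crossing tubes under a
`≤ 2ε` shift of one of them, for the equilibrium hard-sphere gas at fixed small `σ`, `N`-uniformly — unprinted. A typed
HYPOTHESIS of line `Sketch` of crux stmt-AtomisticToContinuum-14535 (a named `Prop` the route posits; nothing is asserted,
it is not a published fact). -/
def TwoDirectionGhostInput (θ₀ : ℝ) : Prop :=
  ∃ C : ℝ, 0 < C ∧ ∃ p : ℝ, 0 < p ∧ ∃ σ₀ : ℝ, 0 < σ₀ ∧ ∀ σ : ℝ, 0 < σ → σ < σ₀ →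
  ∀ τ : ℝ, 0 < τ → ∃ N₀ : ℕ, ∀ N : ℕ, N₀ ≤ N →
    ∀ Ψ : HardSphereFlow (Torus.geometry (Fin 3)) (hsDiameter σ N) (N - 1),
    ∀ (i j : Fin (N + 1)), j ≠ i →
    ∀ emb : Fin (N - 1) ↪ Fin (N + 1), (∀ k : Fin (N + 1), (∃ l, emb l = k) ↔ (k ≠ i ∧ k ≠ j)) →
    let ε : ℝ := hsDiameter σ N
    let w : ℝ := τ * ((N + 1 : ℕ) : ℝ) ^ (-(1 / 3 : ℝ))
    let q : T3 → (Fin 3 → ℤ) := Torus.coarseCell (rhoStar σ * ((N + 1 : ℕ) : ℝ) ^ (-(1 / 3 : ℝ)))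
    let ν : Measure (Fin (N + 1) → T3) := othersLaw ε (N + 1) i
    let γ : Measure (Fin (N + 1) → V3) := Measure.pi fun _ => gaussMeasure (0 : V3) θ₀
    let E : (Fin (N + 1) → V3) → ℝ → V3 → Set (Fin (N + 1) → T3) := fun v t ω => twoTubeEvent Ψ i j emb v t ω
    let φ : (Fin (N + 1) → V3) → V3 → ℝ≥0∞ := fun v ω => ENNReal.ofReal (max (-inner ℝ ω (v i - v j)) 0)
    let κ : (Fin (N + 1) → V3) → ℝ≥0∞ := fun v => ∫⁻ ω, φ v (ω : V3) ∂(sphereMeasure (E := V3))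
    ∃ e : (Fin (N + 1) → V3) → ℝ × V3 × V3 → ℝ≥0∞, Measurable (Function.uncurry e) ∧
      (∫⁻ v, ENNReal.ofReal (ε ^ 2) * (κ v)⁻¹ *
          (∫⁻ ω, (∫⁻ ω', φ v (ω : V3) * φ v (ω' : V3) *
              (∫⁻ t in Set.Ioc 0 w, e v (t, (ω : V3), (ω' : V3)))
            ∂(sphereMeasure (E := V3))) ∂(sphereMeasure (E := V3))) ∂γ) ≤
        ENNReal.ofReal (C * σ ^ p / (N + 1)) ∧
      ∀ (v : Fin (N + 1) → V3) (t : ℝ), t ∈ Set.Ioc 0 w → ∀ (ω ω' : V3), ‖ω‖ = 1 → ‖ω'‖ = 1 →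
        inner ℝ ω (v i - v j) < 0 → inner ℝ ω' (v i - v j) < 0 →
        ∀ G : Set (Fin (N + 1) → T3),
          MeasurableSet[MeasurableSpace.comap (contactCells q ε v i j t ω') inferInstance] G →
          ν (E v t ω ∩ G) ≤ ν (E v t ω' ∩ G) + e v (t, ω, ω') ∧ ν (E v t ω' ∩ G) ≤ ν (E v t ω ∩ G) + e v (t, ω, ω')

end

end Summit.AtomisticToContinuum.HydrodynamicLimit.Theorems.OLC
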